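import Mathlib
import Summits.MatrixMultiplication.Statement
import Summits.MatrixMultiplication.MatrixMultiplication.Theorems.GraphEquationsTopWeightSyzygies

/-!
# The affine–quadric model of cubic equation systems (`GraphEquations`, M40)

Decomp-mm node «GraphEquations» (lens 5 «finite range + asymptotic regime + bridge», g39); attacked
leaf `MultiplicityReduction` (stmt-MatrixMultiplication-27806).  Target of the node, VERBATIM:
`_root_.MatrixMultiplication`.  Route-neutral (`closes` unchanged); imports no `Theses/` file.

## What is typed here

By the cubic normal form NFₙ (`n ≥ 3`, NODE-g38 §3c; its syzygy inputs are the kernel-checked files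
`GraphEquationsOneOneSyzygies`, `…OneSidedSyzygies`, `…TopWeightSyzygies`) every test of total
degree `≤ 3` vanishing on the graph `W_n = {C = AB}` is `Σ_q g_q·(c_q − (AB)_q)` with `g_q` AFFINE in
`(A, B, C)`.  An AFFINE TEST (`AffTest`) records such a test by its coefficient data
`g(A,B,C) = κ + L_A A + L_B B + M C` (`κ ∈ ℂ^{n×n}`, `L_A, L_B, M ∈ End ℂ^{n×n}`); an affine system
(`AffSystem`) is a finite family of them.  On the fibre `C = AB + δ` over `(A, B)` the test equals
`⟨J_g(A,B), δ⟩ + ⟨M δ, δ⟩` (`AffTest.eval_graph_add`) with the `C`-GRADIENT `J_g(A,B) = g(A,B,AB)`;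
so the system is CORRECT (`AffSystem.Correct`: common zero set = graph) iff at every `(A,B)` the
affine-linear forms `⟨J_g(A,B), ·⟩` and the FIXED quadrics `⟨M_g ·, ·⟩` have no common zero
`δ ≠ 0`, and it is REDUCED AT `(A,B)` (`AffSystem.ReducedAt`) iff the gradients `J_g(A,B)` span.
`AffineQuadricRigidity n` (AQRₙ): every correct affine system is reduced at some point.  MEMO
(NODE-g39 §3, paper assembly via NFₙ and `EqSystem.jacobianC`): for `n ≥ 3`,
`AQRₙ ⟺ CubicReduction n` (tree decl, `GraphEquationsCubicRung`); this file proves neither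
direction — it proves CONTENT theorems of the model, all unconditional linear algebra:

* `Correct.eq_zero_of_isKer_of_quad` — a kernel direction (`⟨J_g, δ⟩ = 0 ∀ g`) on which all
  quadratic parts vanish is `0`; hence (`reducedAt_of_quad_eq_zero`, `reducedAt_of_skew`) a correct
  system with alternating quadratic parts is reduced EVERYWHERE, and
  (`not_correct_of_kappa_zero_of_isotropic`) constants are needed as soon as the quadrics have a
  common isotropic vector.
* `not_correct_of_const_ker` (memo Lemma A of NODE-g37, now a theorem) — a CONSTANT kernel field is
  impossible: inclusion–exclusion `M c = J(c,1) − J(c,0) − J(0,1) + J(0,0)` makes it isotropic.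
* `Correct.reducedAt_of_linear_eq_zero` — masking needs the `u`-linear parts: `L_A = L_B = 0`
  forces reducedness everywhere (move the base point along `B = 1`).
* `Correct.not_isKer_of_common_left_ker`, `Correct.exists_affine_ne_zero_of_common_left_ker` — a
  common LEFT KERNEL vector `w` of all `M_g` is isotropic, hence never a kernel direction of a
  correct system, and the affine forms `⟨κ_g + ℓ_g(u), w⟩` have no common zero.  HONEST STATUS:
  a constraint, not a kill, of that sub-case (NODE-g39 §3: the kill needs the `F–β` coupling along
  a kernel curve; IDEA-NEEDED).
* `Correct.exists_linear_ne_zero_of_secant` (memo D4, now a theorem) — secants `A'B' = AB − w`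
  through a kernel direction `w` are seen by the linear parts.
* Base range `affineQuadricRigidity_zero`, `affineQuadricRigidity_one` (mirror of C3₀, C3₁).
The companion file `GraphEquationsAffineQuadricDegeneracy` (M41) proves the LEADING-ORDER
DEGENERACY of nowhere-reduced systems (memo D2) and the rank-one reduction.

Tags (cell census): every theorem here is WEAKER than the summit (fixed-`n` linear algebra over
`ℂ`, no cost, no exponent) and PROVED; `AffineQuadricRigidity n` (`n ≥ 2`) is UNDECIDED(test: the
probe `cubic_ideal_n.py` of g37 — 92/92 escapes at `n = 2` for masks of `u`-degree `≤ 1`) and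
IDEA-NEEDED.  Why novel (search log NODE-g39 §4): the literature on the verification complexity of
bilinear maps bounds degree / decision complexity of graph membership and never studies the
reducedness of cubic test ideals; no `AffTest`-type model was found (corpus + galaxy null queries
listed there).  No `sorry`.
-/

-- dupNamespace: forced by the nested Summit.MatrixMultiplication.MatrixMultiplication layout (D-0017)
set_option linter.dupNamespace false

noncomputable section

namespace Summit.MatrixMultiplication.MatrixMultiplication.Theorems.GraphEquations

open Matrix Polynomial

variable {n : ℕ}

/-! ## Vectors and operators on index pairs -/

/-- `ℂ^{n×n}` as functions on index pairs (each of the blocks `A`, `B`, `C`). -/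
abbrev Vec (n : ℕ) : Type := Fin n × Fin n → ℂ

/-- Linear operators `ℂ^{n×n} → ℂ^{n×n}` as square matrices on index pairs. -/
abbrev SqMat (n : ℕ) : Type := Matrix (Fin n × Fin n) (Fin n × Fin n) ℂ

/-- The product `AB` as a vector: `(prodVec A B)_q = (AB)_q = Σ_k A_{q₁k} B_{kq₂}`. -/
def prodVec (A B : Vec n) : Vec n := fun q => prodEntry q A B

/-- Entries of `prodVec`. -/
theorem prodVec_apply (A B : Vec n) (q : Fin n × Fin n) : prodVec A B q = prodEntry q A B := rfl

/-- `0·B = 0`. -/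
theorem prodVec_zero_left (B : Vec n) : prodVec 0 B = 0 := by
  funext q; simp [prodVec, prodEntry]

/-- `A·0 = 0`. -/
theorem prodVec_zero_right (A : Vec n) : prodVec A 0 = 0 := by
  funext q; simp [prodVec, prodEntry]

/-- `(sA)·B = s·(AB)`. -/
theorem prodVec_smul_left (s : ℂ) (A B : Vec n) : prodVec (s • A) B = s • prodVec A B := by
  funext q; simp [prodVec, prodEntry, Finset.mul_sum, mul_assoc]

/-- `A·(tB) = t·(AB)`. -/
theorem prodVec_smul_right (t : ℂ) (A B : Vec n) : prodVec A (t • B) = t • prodVec A B := by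
  funext q; simp [prodVec, prodEntry, Finset.mul_sum, mul_left_comm]

/-- `A·1 = A`. -/
theorem prodVec_idFun (A : Vec n) : prodVec A idFun = A := by
  funext q; exact prodEntry_idFun q A

/-! ## Affine tests -/

/-- An AFFINE TEST for the graph: the cubic polynomial `Σ_q g_q(A,B,C)·(c_q − (AB)_q)` with affine
coefficient vector `g(A,B,C) = κ + L_A A + L_B B + M C`, recorded by `(κ, L_A, L_B, M)`. -/
structure AffTest (n : ℕ) where
  /-- constant part `κ` of the coefficient vector -/
  κ : Vec n
  /-- part linear in `A` -/
  LA : SqMat n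
  /-- part linear in `B` -/
  LB : SqMat n
  /-- part linear in `C` (the QUADRATIC PART of the test in the fibre direction) -/
  M : SqMat n

namespace AffTest

variable (g : AffTest n)

/-- The coefficient vector `g(A,B,C) = κ + L_A A + L_B B + M C`. -/
def coef (A B C : Vec n) : Vec n := g.κ + g.LA *ᵥ A + g.LB *ᵥ B + g.M *ᵥ C

/-- The value of the test at `(A,B,C)`: `⟨g(A,B,C), C − AB⟩`. -/
def eval (A B C : Vec n) : ℂ := g.coef A B C ⬝ᵥ (C - prodVec A B)

/-- The `C`-gradient of the test on the graph: `J_g(A,B) = g(A,B,AB)`. -/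
def jac (A B : Vec n) : Vec n := g.coef A B (prodVec A B)

/-- The quadratic part in the fibre direction: `β_g(δ) = ⟨M δ, δ⟩`. -/
def quad (δ : Vec n) : ℂ := (g.M *ᵥ δ) ⬝ᵥ δ

/-- The gradient, unfolded. -/
theorem jac_eq (A B : Vec n) :
    g.jac A B = g.κ + g.LA *ᵥ A + g.LB *ᵥ B + g.M *ᵥ prodVec A B := rfl

/-- The test vanishes on the graph. -/
theorem eval_graph (A B : Vec n) : g.eval A B (prodVec A B) = 0 := by
  simp [eval]

/-- The coefficient vector on the fibre `C = AB + δ`. -/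
theorem coef_graph_add (A B δ : Vec n) :
    g.coef A B (prodVec A B + δ) = g.jac A B + g.M *ᵥ δ := by
  simp only [coef, jac, mulVec_add]
  abel

/-- **Fibre identity.**  On the fibre `C = AB + δ` the test is `⟨J_g(A,B), δ⟩ + ⟨M δ, δ⟩`:
affine-linear plus a quadric that does not depend on the base point. -/
theorem eval_graph_add (A B δ : Vec n) :
    g.eval A B (prodVec A B + δ) = g.jac A B ⬝ᵥ δ + g.quad δ := by
  rw [eval, coef_graph_add, add_sub_cancel_left, add_dotProduct, quad]

/-- Inclusion–exclusion: the quadratic part is read off from four values of the gradient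
(`A = c`, `B ∈ {0, 1}`; `c·1 = c`). -/
theorem mulVec_eq_jac_comb (c : Vec n) :
    g.M *ᵥ c = g.jac c idFun - g.jac c 0 - g.jac 0 idFun + g.jac 0 0 := by
  simp only [jac_eq, prodVec_idFun, prodVec_zero_right, mulVec_zero, add_zero]
  abel

/-- The gradient along the two-parameter family `(A,B) = (s·c, t·1)`. -/
theorem jac_smul_smul_idFun (c : Vec n) (s t : ℂ) :
    g.jac (s • c) (t • idFun) =
      g.κ + s • (g.LA *ᵥ c) + t • (g.LB *ᵥ idFun) + (s * t) • (g.M *ᵥ c) := by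
  simp only [jac_eq, prodVec_smul_right, prodVec_idFun, mulVec_smul, mul_smul]
  rw [smul_comm t s]

/-- An alternating quadratic part vanishes on the diagonal (char `0`). -/
theorem quad_eq_zero_of_transpose_eq_neg (h : g.Mᵀ = -g.M) (δ : Vec n) : g.quad δ = 0 := by
  have h1 : g.quad δ = δ ⬝ᵥ (g.M *ᵥ δ) := dotProduct_comm _ _
  have h2 : δ ⬝ᵥ (g.M *ᵥ δ) = -g.quad δ := by
    rw [dotProduct_mulVec, ← mulVec_transpose, h, neg_mulVec, neg_dotProduct, quad]
  have h3 : (2 : ℂ) * g.quad δ = 0 := by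
    rw [two_mul]
    nth_rewrite 1 [h1]
    rw [h2, neg_add_cancel]
  simpa using h3

/-- A left kernel vector of `M` is isotropic for `⟨M ·, ·⟩`. -/
theorem quad_eq_zero_of_vecMul_eq_zero {w : Vec n} (h : w ᵥ* g.M = 0) : g.quad w = 0 := by
  rw [quad, dotProduct_comm, dotProduct_mulVec, h, zero_dotProduct]

/-- A left kernel vector of `M` is orthogonal to the image of `M`. -/
theorem mulVec_dotProduct_eq_zero_of_vecMul_eq_zero {w : Vec n} (h : w ᵥ* g.M = 0) (x : Vec n) :
    (g.M *ᵥ x) ⬝ᵥ w = 0 := by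
  rw [dotProduct_comm, dotProduct_mulVec, h, zero_dotProduct]

end AffTest

/-! ## Affine systems: correctness, kernel directions, reducedness -/

/-- A finite AFFINE SYSTEM of tests for the graph `W_n`. -/
structure AffSystem (n : ℕ) where
  /-- number of tests -/
  m : ℕ
  /-- the tests -/
  test : Fin m → AffTest n

namespace AffSystem

variable (S : AffSystem n)

/-- CORRECT: the common zero set of the tests is exactly the graph `{C = AB}` (the tests vanish on
the graph automatically, `AffTest.eval_graph`). -/
def Correct : Prop := ∀ A B C : Vec n, (∀ i, (S.test i).eval A B C = 0) → C = prodVec A B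

/-- `δ` is a KERNEL DIRECTION at `(A,B)`: every `C`-gradient is orthogonal to `δ`. -/
def IsKer (A B δ : Vec n) : Prop := ∀ i, (S.test i).jac A B ⬝ᵥ δ = 0

/-- REDUCED AT `(A,B)`: the `C`-gradients span, i.e. the only kernel direction is `0`. -/
def ReducedAt (A B : Vec n) : Prop := ∀ δ : Vec n, S.IsKer A B δ → δ = 0

/-- NOWHERE REDUCED: at every point of the graph there is a non-zero kernel direction (the shape of
a hypothetical counterexample to C3ₙ). -/
def NowhereReduced : Prop := ∀ A B : Vec n, ¬ S.ReducedAt A B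

variable {S}

/-- The zero vector is a kernel direction. -/
theorem isKer_zero (A B : Vec n) : S.IsKer A B 0 := fun i => by simp

/-- Not reduced at `(A,B)` iff there is a non-zero kernel direction. -/
theorem not_reducedAt_iff (A B : Vec n) : ¬ S.ReducedAt A B ↔ ∃ δ, S.IsKer A B δ ∧ δ ≠ 0 := by
  simp [ReducedAt]

/-- **Correctness kills isotropic kernel directions.**  If `δ` is a kernel direction at `(A,B)` and
every quadratic part vanishes at `δ`, then `(A, B, AB + δ)` passes all tests, so `δ = 0`. -/
theorem Correct.eq_zero_of_isKer_of_quad (hC : S.Correct) {A B δ : Vec n} (hK : S.IsKer A B δ)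
    (hq : ∀ i, (S.test i).quad δ = 0) : δ = 0 := by
  have h := hC A B (prodVec A B + δ) fun i => by
    rw [AffTest.eval_graph_add, hK i, hq i, add_zero]
  simpa using h

/-- Contrapositive packaging of `Correct.eq_zero_of_isKer_of_quad`. -/
theorem not_correct_of_isKer_of_quad {A B δ : Vec n} (hδ : δ ≠ 0) (hK : S.IsKer A B δ)
    (hq : ∀ i, (S.test i).quad δ = 0) : ¬ S.Correct :=
  fun hC => hδ (hC.eq_zero_of_isKer_of_quad hK hq)

/-- **No quadratic part, no masking.**  If all quadratic parts vanish identically on the diagonal,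
a correct system is reduced at EVERY point. -/
theorem Correct.reducedAt_of_quad_eq_zero (hC : S.Correct) (hq : ∀ i δ, (S.test i).quad δ = 0)
    (A B : Vec n) : S.ReducedAt A B :=
  fun _ hK => hC.eq_zero_of_isKer_of_quad hK fun i => hq i _

/-- In particular alternating quadratic parts (`Mᵀ = −M`) never mask. -/
theorem Correct.reducedAt_of_skew (hC : S.Correct) (hskew : ∀ i, (S.test i).Mᵀ = -(S.test i).M)
    (A B : Vec n) : S.ReducedAt A B :=
  hC.reducedAt_of_quad_eq_zero (fun i δ => (S.test i).quad_eq_zero_of_transpose_eq_neg (hskew i) δ)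
    A B

/-- **Constants are needed.**  If all `κ_g = 0` then every vector is a kernel direction at the
origin, so a common isotropic vector `δ ≠ 0` of the quadratic parts defeats correctness. -/
theorem not_correct_of_kappa_zero_of_isotropic (hκ : ∀ i, (S.test i).κ = 0) {δ : Vec n}
    (hδ : δ ≠ 0) (hq : ∀ i, (S.test i).quad δ = 0) : ¬ S.Correct := by
  refine not_correct_of_isKer_of_quad hδ (A := 0) (B := 0) (fun i => ?_) hq
  simp [AffTest.jac_eq, hκ i, prodVec_zero_left]

/-- **No constant kernel field** (memo Lemma A).  A fixed `w ≠ 0` cannot be a kernel direction at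
every point of a correct system: inclusion–exclusion makes `w` isotropic for every `M_g`. -/
theorem not_correct_of_const_ker {w : Vec n} (hw : w ≠ 0) (hK : ∀ A B, S.IsKer A B w) :
    ¬ S.Correct := by
  refine not_correct_of_isKer_of_quad hw (hK 0 0) fun i => ?_
  rw [AffTest.quad, AffTest.mulVec_eq_jac_comb, add_dotProduct, sub_dotProduct, sub_dotProduct,
    hK w idFun i, hK w 0 i, hK 0 idFun i, hK 0 0 i]
  ring

/-- **Masking needs the `u`-linear parts.**  If `L_A = L_B = 0` for every test, a correct system is
reduced at every point: a kernel direction `δ` at `(A,B)` makes `(AB − δ, 1, AB)` pass all tests. -/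
theorem Correct.reducedAt_of_linear_eq_zero (hC : S.Correct) (hA : ∀ i, (S.test i).LA = 0)
    (hB : ∀ i, (S.test i).LB = 0) (A B : Vec n) : S.ReducedAt A B := by
  intro δ hK
  have key : ∀ i, (S.test i).eval (prodVec A B - δ) idFun (prodVec A B) = 0 := by
    intro i
    have hcoef : (S.test i).coef (prodVec A B - δ) idFun (prodVec A B) = (S.test i).jac A B := by
      simp [AffTest.coef, AffTest.jac_eq, hA i, hB i]
    rw [AffTest.eval, hcoef, prodVec_idFun, sub_sub_cancel]
    exact hK i
  have h := hC _ _ _ key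
  rw [prodVec_idFun] at h
  have h' : prodVec A B - δ = prodVec A B := h.symm
  simpa using h'

/-! ## Common left kernel vectors of the quadratic parts -/

/-- A common left kernel vector `w ≠ 0` of the quadratic parts is never a kernel direction of a
correct system (it is isotropic for every `M_g`). -/
theorem Correct.not_isKer_of_common_left_ker (hC : S.Correct) {w : Vec n} (hw : w ≠ 0)
    (hL : ∀ i, w ᵥ* (S.test i).M = 0) (A B : Vec n) : ¬ S.IsKer A B w :=
  fun hK => hw (hC.eq_zero_of_isKer_of_quad hK fun i => (S.test i).quad_eq_zero_of_vecMul_eq_zero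
    (hL i))

/-- **What correctness forces in the common-left-kernel sub-case:** at every `(A,B)` some affine
form `⟨κ_g + L_A A + L_B B, w⟩` is non-zero (the `M`-term is invisible to `w`).  Honest status: this
is a constraint, not a contradiction — the sub-case is NOT closed by leading-order arguments. -/
theorem Correct.exists_affine_ne_zero_of_common_left_ker (hC : S.Correct) {w : Vec n} (hw : w ≠ 0)
    (hL : ∀ i, w ᵥ* (S.test i).M = 0) (A B : Vec n) :
    ∃ i, ((S.test i).κ + (S.test i).LA *ᵥ A + (S.test i).LB *ᵥ B) ⬝ᵥ w ≠ 0 := by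
  by_contra h
  push Not at h
  refine hC.not_isKer_of_common_left_ker hw hL A B fun i => ?_
  rw [AffTest.jac_eq, add_dotProduct, h i, (S.test i).mulVec_dotProduct_eq_zero_of_vecMul_eq_zero
    (hL i), add_zero]

/-! ## Secants through a kernel direction -/

/-- **Secant lemma (memo D4).**  If `w ≠ 0` is a kernel direction at `(A,B)` of a correct system and
`A'B' = AB − w`, then some linear part sees the secant: `⟨L_A(A' − A) + L_B(B' − B), w⟩ ≠ 0`
(otherwise `(A', B', AB)` passes all tests). -/
theorem Correct.exists_linear_ne_zero_of_secant (hC : S.Correct) {A B A' B' w : Vec n} (hw : w ≠ 0)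
    (hK : S.IsKer A B w) (hsec : prodVec A' B' = prodVec A B - w) :
    ∃ i, ((S.test i).LA *ᵥ (A' - A) + (S.test i).LB *ᵥ (B' - B)) ⬝ᵥ w ≠ 0 := by
  by_contra h
  push Not at h
  have key : ∀ i, (S.test i).eval A' B' (prodVec A B) = 0 := by
    intro i
    have hcoef : (S.test i).coef A' B' (prodVec A B) =
        (S.test i).jac A B + ((S.test i).LA *ᵥ (A' - A) + (S.test i).LB *ᵥ (B' - B)) := by
      simp only [AffTest.coef, AffTest.jac_eq, mulVec_sub]
      abel
    rw [AffTest.eval, hsec, sub_sub_cancel, hcoef, add_dotProduct, hK i, h i, add_zero]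
  have h' := hC _ _ _ key
  rw [hsec] at h'
  have h'' : prodVec A B - w = prodVec A B := h'.symm
  exact hw (by simpa using h'')

/-! ## Affine–quadric rigidity: the statement and its base range -/

/-- **AQRₙ (affine–quadric rigidity).**  Every correct affine system for the graph `W_n` is reduced
at some point.  UNDECIDED for `n ≥ 2`; MEMO: `⟺ CubicReduction n` for `n ≥ 3` via the cubic normal
form (NODE-g38 §3c, NODE-g39 §3). -/
def AffineQuadricRigidity (n : ℕ) : Prop :=
  ∀ S : AffSystem n, S.Correct → ∃ A B : Vec n, S.ReducedAt A B

/-- AQRₙ says exactly: no correct system is nowhere reduced. -/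
theorem affineQuadricRigidity_iff :
    AffineQuadricRigidity n ↔ ∀ S : AffSystem n, S.Correct → ¬ S.NowhereReduced := by
  simp [AffineQuadricRigidity, AffSystem.NowhereReduced]

/-- Base range: AQR₀ (no variables). -/
theorem affineQuadricRigidity_zero : AffineQuadricRigidity 0 :=
  fun _ _ => ⟨0, 0, fun δ _ => Subsingleton.elim δ 0⟩

/-- Base range: AQR₁ — in one variable a nowhere-reduced system has the constant kernel field `1`,
which `not_correct_of_const_ker` forbids. -/
theorem affineQuadricRigidity_one : AffineQuadricRigidity 1 := by
  rw [affineQuadricRigidity_iff]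
  intro S hC hNR
  refine not_correct_of_const_ker (S := S) (w := fun _ => 1) (fun h => ?_) (fun A B i => ?_) hC
  · simpa using congrFun h ((0 : Fin 1), (0 : Fin 1))
  · obtain ⟨δ, hK, hδ⟩ := (not_reducedAt_iff A B).mp (hNR A B)
    have hδq : δ = δ (0, 0) • fun _ => (1 : ℂ) := by
      funext q
      rw [Subsingleton.elim q ((0 : Fin 1), (0 : Fin 1))]
      simp
    have hδ0 : δ (0, 0) ≠ 0 := by
      intro h0; apply hδ; rw [hδq, h0, zero_smul]
    have h := hK i
    rw [hδq, dotProduct_smul, smul_eq_mul] at h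
    exact (mul_eq_zero.mp h).resolve_left hδ0

end AffSystem

end Summit.MatrixMultiplication.MatrixMultiplication.Theorems.GraphEquations

end
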